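import Summits.AtomisticToContinuum.HydrodynamicLimit.Theses.JParityClosure
import Literature.MathematicalPhysics.KineticTheory.HardSphereEulerProofs
import HarnessLib

/-!
# `JParityClosure.CollisionTightness` (stmt-AtomisticToContinuum-13085): domination of the local
# Gibbs laws by a homogeneous Gibbs law, and the reduction of collision tightness to equilibrium
# exponential tails

Helper file (`--supports stmt-AtomisticToContinuum-13085`) for the support item `CollisionTightness`
of the route `JParityClosure`: tightness, uniformly in `N`, of the normalised collision count
`X_N = ε_N (N+1)⁻¹ · #{collisions in [0, τ]}` of `N + 1` hard spheres of diameter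
`ε_N = σ (N+1)^{-1/3}` on `𝕋³` under the LOCAL Gibbs law with continuous profiles `(a₀, u₀, θ₀)`.

What is proved here.

* `exists_profile_bounds` — continuous profiles on the compact torus are bounded above and below.
* `exists_localGibbsProfile_le_const` — the one-body local Gibbs profile
  `a₀(x) M_{1,u₀(x),θ₀(x)}(v)` is dominated by `C · M_{1,0,θ₁}(v)`, `θ₁ = 2 sup θ₀` (complete the
  square: `‖v‖² ≤ 2‖v − u‖² + 2‖u‖²`).
* `const_pow_mul_posPartition_one_le` — `a^{N+1} Z_pos(1) ≤ Z_pos(a₀)` for `a ≤ a₀`.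
* `canonicalDensity_le_const_mul`, `exists_localGibbsMeasure_le_smul_const` — **domination**: for
  continuous profiles there are `θ₁ > 0` and `Λ ≥ 1` with
  `localGibbsMeasure σ a₀ u₀ θ₀ N ≤ Λ^{N+1} • localGibbsMeasure σ 1 0 θ₁ N` for every `σ ≤ 1/2` and
  every `N` (pointwise comparison of the canonical densities; the homogeneous law
  `localGibbsLaw σ 1 0 θ₁ N Φ` is invariant under every hard-sphere flow,
  `map_flow_localGibbsLaw_const`).
* `collisionTightness_of_equilibrium_exp_tails` — **the reduction**: IF under the homogeneous Gibbs
  laws the normalised collision count has exponentially small upper tails at every rate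
  (`∀ c ∃ K N₀ ∀ N ≥ N₀, G_N{K < X_N} ≤ exp(−c (N+1))`), THEN `CollisionTightness` holds (take
  `c = log Λ + 1`).

What is NOT proved, and why (see the evidence memo attached to the item). The exponential loss
`Λ^{N+1}` is intrinsic to any global comparison of a local Gibbs law with an invariant law (the
relative entropy is of order `N`), so transferring collision statistics from equilibrium to local
Gibbs data needs LARGE-DEVIATION upper bounds at speed `N` for the collision count of the
deterministic hard-sphere gas in equilibrium — unknown (the only worst-case bound on collision
numbers of `s`-sphere clusters, Burago–Ferleger–Kononenko 1998, is super-exponential in `s`) and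
possibly false at that speed (clusters with exponentially many collisions, Burago–Ivanov 2018). The
hypothesis of the reduction is therefore recorded as the precise statement the entropy/domination
route needs, not as a claim.

References: H. Spohn, *Large Scale Dynamics of Interacting Particles* (1991), Part I §2.3–§3;
C. Kipnis, C. Landim, *Scaling Limits of Interacting Particle Systems* (1999), App. 1.8 (entropy
inequality); D. Burago, S. Ferleger, A. Kononenko, Ann. of Math. 147 (1998) 695–708.
-/

noncomputable section

open MeasureTheory Set Filter Topology
open scoped ENNReal

namespace Summit.AtomisticToContinuum.HydrodynamicLimit.Theorems

open Literature.Analysis.FluidPDE Literature.MathematicalPhysics.KineticTheory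

variable {a₀ θ₀ : T3 → ℝ} {u₀ : T3 → V3}

/-- Continuous profiles on the compact torus `𝕋³` are bounded: `a ≤ a₀ ≤ A`, `ϑ ≤ θ₀ ≤ Θ`,
`‖u₀‖ ≤ U` with `a, ϑ > 0` when `a₀, θ₀ > 0`. [folklore] -/
theorem exists_profile_bounds (ha : Continuous a₀) (hθ : Continuous θ₀) (hu : Continuous u₀)
    (ha0 : ∀ x, 0 < a₀ x) (hθ0 : ∀ x, 0 < θ₀ x) :
    ∃ A a Θ ϑ U : ℝ, 0 < a ∧ 0 < ϑ ∧ 0 ≤ U ∧ (∀ x, a₀ x ≤ A) ∧ (∀ x, a ≤ a₀ x) ∧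
      (∀ x, θ₀ x ≤ Θ) ∧ (∀ x, ϑ ≤ θ₀ x) ∧ ∀ x, ‖u₀ x‖ ≤ U := by
  obtain ⟨A, -, hA⟩ := exists_forall_abs_le_of_continuous ha
  obtain ⟨Θ, -, hΘ⟩ := exists_forall_abs_le_of_continuous hθ
  obtain ⟨U, hU0, hU⟩ := exists_forall_abs_le_of_continuous (continuous_norm.comp hu)
  obtain ⟨xa, -, hxa⟩ := isCompact_univ.exists_isMinOn univ_nonempty ha.continuousOn
  obtain ⟨xθ, -, hxθ⟩ := isCompact_univ.exists_isMinOn univ_nonempty hθ.continuousOn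
  refine ⟨A, a₀ xa, Θ, θ₀ xθ, U, ha0 xa, hθ0 xθ, hU0, fun x => (le_abs_self _).trans (hA x),
    fun x => (isMinOn_iff.1 hxa) x (mem_univ x), fun x => (le_abs_self _).trans (hΘ x),
    fun x => (isMinOn_iff.1 hxθ) x (mem_univ x), fun x => ?_⟩
  have h := hU x
  simp only [Function.comp_apply, abs_norm] at h
  exact h

/-- `‖v‖² ≤ 2 ‖v − u‖² + 2 ‖u‖²`. [folklore] -/
theorem norm_sq_le_two_mul_add (v u : V3) : ‖v‖ ^ 2 ≤ 2 * ‖v - u‖ ^ 2 + 2 * ‖u‖ ^ 2 := by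
  have h1 : ‖v‖ ≤ ‖v - u‖ + ‖u‖ := by
    calc ‖v‖ = ‖(v - u) + u‖ := by rw [sub_add_cancel]
      _ ≤ ‖v - u‖ + ‖u‖ := norm_add_le _ _
  have h2 : 0 ≤ ‖v - u‖ := norm_nonneg _
  have h3 : 0 ≤ ‖u‖ := norm_nonneg _
  have h4 : 0 ≤ ‖v‖ := norm_nonneg _
  nlinarith [h1, h2, h3, h4, sq_nonneg (‖v - u‖ - ‖u‖)]

/-- **Gaussian domination of the one-body local Gibbs profile.** If `0 ≤ a₀ ≤ A`, `0 < ϑ ≤ θ₀ ≤ Θ`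
and `‖u₀‖ ≤ U`, then `a₀(x) M_{1,u₀(x),θ₀(x)}(v) ≤ C · M_{1,0,2Θ}(v)` for an explicit constant `C > 0`
(bound the prefactor by `(2πϑ)^{-d/2}`, the exponent by completing the square). [folklore] -/
theorem exists_localGibbsProfile_le_const {A Θ ϑ U : ℝ} (ha0 : ∀ x, 0 ≤ a₀ x) (hA : ∀ x, a₀ x ≤ A)
    (hϑ0 : 0 < ϑ) (hϑ : ∀ x, ϑ ≤ θ₀ x) (hΘ : ∀ x, θ₀ x ≤ Θ) (hU : ∀ x, ‖u₀ x‖ ≤ U) :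
    ∃ C : ℝ, 0 < C ∧ ∀ y : T3 × V3,
      localGibbsProfile a₀ u₀ θ₀ y ≤
        C * localGibbsProfile (fun _ => 1) (fun _ => (0 : V3)) (fun _ => 2 * Θ) y := by
  have hΘ0 : 0 < Θ := hϑ0.trans_le ((hϑ 0).trans (hΘ 0))
  set d : ℝ := (Module.finrank ℝ V3 : ℝ) with hd
  have hd0 : 0 ≤ d := by rw [hd]; exact_mod_cast Nat.zero_le _
  set c₁ : ℝ := (2 * Real.pi * ϑ) ^ (-d / 2) with hc₁
  set c₂ : ℝ := (2 * Real.pi * (2 * Θ)) ^ (-d / 2) with hc₂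
  have hc₁0 : 0 < c₁ := Real.rpow_pos_of_pos (by positivity) _
  have hc₂0 : 0 < c₂ := Real.rpow_pos_of_pos (by positivity) _
  have hA0 : 0 ≤ A := (ha0 0).trans (hA 0)
  set E₀ : ℝ := Real.exp (U ^ 2 / (2 * Θ)) with hE₀
  have hE₀0 : 0 < E₀ := Real.exp_pos _
  refine ⟨(A + 1) * c₁ * E₀ / c₂, by positivity, fun y => ?_⟩
  obtain ⟨x, v⟩ := y
  have hθx : 0 < θ₀ x := hϑ0.trans_le (hϑ x)
  -- the three factors of the local Gibbs profile
  have hpre : (2 * Real.pi * θ₀ x) ^ (-d / 2) ≤ c₁ :=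
    Real.rpow_le_rpow_of_nonpos (by positivity) (by nlinarith [hϑ x, Real.pi_pos])
      (by linarith)
  have hexp : Real.exp (-‖v - u₀ x‖ ^ 2 / (2 * θ₀ x)) ≤
      E₀ * Real.exp (-‖v - 0‖ ^ 2 / (2 * (2 * Θ))) := by
    rw [hE₀, ← Real.exp_add, sub_zero]
    refine Real.exp_le_exp.2 ?_
    have h1 : -‖v - u₀ x‖ ^ 2 / (2 * θ₀ x) ≤ -‖v - u₀ x‖ ^ 2 / (2 * Θ) := by
      rw [neg_div, neg_div, neg_le_neg_iff]
      exact div_le_div_of_nonneg_left (sq_nonneg _) (by positivity) (by linarith [hΘ x])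
    have h2 : -‖v - u₀ x‖ ^ 2 ≤ U ^ 2 - ‖v‖ ^ 2 / 2 := by
      have := norm_sq_le_two_mul_add v (u₀ x)
      have hu2 : ‖u₀ x‖ ^ 2 ≤ U ^ 2 := by
        have := hU x
        have h0 : 0 ≤ ‖u₀ x‖ := norm_nonneg _
        nlinarith
      nlinarith
    have h3 : -‖v - u₀ x‖ ^ 2 / (2 * Θ) ≤ (U ^ 2 - ‖v‖ ^ 2 / 2) / (2 * Θ) :=
      div_le_div_of_nonneg_right h2 (by positivity)
    have h4 : (U ^ 2 - ‖v‖ ^ 2 / 2) / (2 * Θ) = U ^ 2 / (2 * Θ) + -‖v‖ ^ 2 / (2 * (2 * Θ)) := by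
      field_simp
      ring
    linarith
  have hax : a₀ x ≤ A + 1 := (hA x).trans (by linarith)
  have hQ : localGibbsProfile (fun _ => 1) (fun _ => (0 : V3)) (fun _ => 2 * Θ) (x, v) =
      c₂ * Real.exp (-‖v - 0‖ ^ 2 / (2 * (2 * Θ))) := by
    simp only [localGibbsProfile, localMaxwellian, one_mul, hc₂]
    rfl
  calc localGibbsProfile a₀ u₀ θ₀ (x, v)
      = a₀ x * ((2 * Real.pi * θ₀ x) ^ (-d / 2) * Real.exp (-‖v - u₀ x‖ ^ 2 / (2 * θ₀ x))) := by
        simp only [localGibbsProfile, localMaxwellian, one_mul]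
        rfl
    _ ≤ (A + 1) * (c₁ * (E₀ * Real.exp (-‖v - 0‖ ^ 2 / (2 * (2 * Θ))))) := by
        refine mul_le_mul hax ?_ (by positivity) (by positivity)
        exact mul_le_mul hpre hexp (by positivity) hc₁0.le
    _ = (A + 1) * c₁ * E₀ / c₂ *
          localGibbsProfile (fun _ => 1) (fun _ => (0 : V3)) (fun _ => 2 * Θ) (x, v) := by
        rw [hQ]
        field_simp

/-! ### Partition functions and the canonical densities -/

/-- `aⁿ · 𝟙_{no overlap} ≤ 𝟙_{no overlap} ∏ᵢ a₀(xᵢ)` pointwise, for `0 ≤ a ≤ a₀`. [folklore] -/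
theorem const_pow_mul_posWeight_one_le {a : ℝ} (ha : 0 ≤ a) (haa : ∀ x, a ≤ a₀ x) (ε : ℝ)
    {n : ℕ} (x : Fin n → T3) :
    a ^ n * posWeight (fun _ => (1 : ℝ)) ε n x ≤ posWeight a₀ ε n x := by
  unfold posWeight
  by_cases hx : x ∈ posDomain ε n
  · rw [indicator_of_mem hx, indicator_of_mem hx]
    simp only [Finset.prod_const_one, mul_one]
    calc a ^ n = ∏ _i : Fin n, a := by simp
      _ ≤ ∏ i, a₀ (x i) := Finset.prod_le_prod (fun _ _ => ha) fun i _ => haa (x i)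
  · rw [indicator_of_notMem hx, indicator_of_notMem hx, mul_zero]

/-- **Lower bound on the configurational partition function**: `aⁿ Z_pos(1) ≤ Z_pos(a₀)` for a
continuous activity `a₀ ≥ a ≥ 0` (`Z_pos(1)` is the Haar measure of the non-overlap set).
[folklore] -/
theorem const_pow_mul_posPartition_one_le (hac : Continuous a₀) {a : ℝ} (ha : 0 ≤ a)
    (haa : ∀ x, a ≤ a₀ x) (ε : ℝ) (n : ℕ) :
    a ^ n * posPartition (fun _ => (1 : ℝ)) ε n ≤ posPartition a₀ ε n := by
  unfold posPartition
  rw [← integral_const_mul]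
  exact integral_mono
    ((integrable_posWeight continuous_const (fun _ => zero_le_one) ε n).const_mul _)
    (integrable_posWeight hac (fun x => ha.trans (haa x)) ε n)
    fun x => const_pow_mul_posWeight_one_le ha haa ε x

/-- The canonical density of a nonnegative profile is nonnegative. [folklore] -/
theorem canonicalDensity_nonneg' {f : T3 × V3 → ℝ} (hf : 0 ≤ f) (ε : ℝ) (n : ℕ)
    (z : Config n (Fin 3) T3) :
    0 ≤ canonicalDensity (Torus.geometry (Fin 3)) ε n f z :=
  mul_nonneg (inv_nonneg.2 (canonicalPartition_nonneg _ _ _ hf))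
    (indicator_nonneg (fun w _ => tensorPow_nonneg hf n w) z)

/-- **Pointwise domination of the canonical densities.** For continuous profiles with
`0 < a ≤ a₀`, `0 < θ₀`, a pointwise one-body bound `f_{a₀,u₀,θ₀} ≤ C f_{1,0,θ₁}` (`C ≥ 0`,
`θ₁ > 0`) and spheres that fit (`σ ≤ 1/2`), the canonical local Gibbs density is at most
`(C/a)^{N+1}` times the homogeneous one: `Z(a₀)⁻¹ ∏ f_{a₀,u₀,θ₀}(zᵢ) ≤ (C/a)^{N+1} Z(1)⁻¹ ∏ f_{1,0,θ₁}(zᵢ)`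
on the hard-sphere domain (`Z(a₀) ≥ a^{N+1} Z(1) > 0`). [folklore] -/
theorem canonicalDensity_le_const_mul (ha : Continuous a₀) (hθ : Continuous θ₀)
    (hu : Continuous u₀) (ha0 : ∀ x, 0 < a₀ x) (hθ0 : ∀ x, 0 < θ₀ x) {a C θ₁ : ℝ} (ha_pos : 0 < a)
    (haa : ∀ x, a ≤ a₀ x) (hθ₁ : 0 < θ₁)
    (hC : ∀ y, localGibbsProfile a₀ u₀ θ₀ y ≤
      C * localGibbsProfile (fun _ => 1) (fun _ => (0 : V3)) (fun _ => θ₁) y)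
    {σ : ℝ} (hσ : σ ≤ 1 / 2) (N : ℕ) (z : Config (N + 1) (Fin 3) T3) :
    canonicalDensity (Torus.geometry (Fin 3)) (hsDiameter σ N) (N + 1)
        (localGibbsProfile a₀ u₀ θ₀) z ≤
      (C / a) ^ (N + 1) * canonicalDensity (Torus.geometry (Fin 3)) (hsDiameter σ N) (N + 1)
        (localGibbsProfile (fun _ => 1) (fun _ => (0 : V3)) (fun _ => θ₁)) z := by
  have ha0' : ∀ x, 0 ≤ a₀ x := fun x => (ha0 x).le
  have hZP : canonicalPartition (Torus.geometry (Fin 3)) (hsDiameter σ N) (N + 1)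
      (localGibbsProfile a₀ u₀ θ₀) = posPartition a₀ (hsDiameter σ N) (N + 1) :=
    canonicalPartition_eq_posPartition ha hθ hu ha0' hθ0 _ _
  have hZQ : canonicalPartition (Torus.geometry (Fin 3)) (hsDiameter σ N) (N + 1)
      (localGibbsProfile (fun _ => 1) (fun _ => (0 : V3)) (fun _ => θ₁)) =
        posPartition (fun _ => (1 : ℝ)) (hsDiameter σ N) (N + 1) :=
    canonicalPartition_eq_posPartition continuous_const continuous_const continuous_const
      (fun _ => zero_le_one) (fun _ => hθ₁) _ _
  have hZQpos : 0 < posPartition (fun _ => (1 : ℝ)) (hsDiameter σ N) (N + 1) :=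
    posPartition_pos continuous_const (fun _ => one_pos) hσ N
  have hZPge : a ^ (N + 1) * posPartition (fun _ => (1 : ℝ)) (hsDiameter σ N) (N + 1) ≤
      posPartition a₀ (hsDiameter σ N) (N + 1) :=
    const_pow_mul_posPartition_one_le ha ha_pos.le haa _ _
  have hfP0 : 0 ≤ localGibbsProfile a₀ u₀ θ₀ :=
    fun y => localGibbsProfile_nonneg ha0' (fun x => (hθ0 x).le) y
  have hfQ0 : 0 ≤ localGibbsProfile (fun _ => 1) (fun _ => (0 : V3)) (fun _ => θ₁) :=
    fun y => localGibbsProfile_nonneg (fun _ => zero_le_one) (fun _ => hθ₁.le) y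
  unfold canonicalDensity
  rw [hZP, hZQ]
  by_cases hz : z ∈ hardSphereDomain (Torus.geometry (Fin 3)) (N + 1) (hsDiameter σ N)
  · rw [indicator_of_mem hz, indicator_of_mem hz]
    have htp : tensorPow (N + 1) (localGibbsProfile a₀ u₀ θ₀) z ≤
        C ^ (N + 1) *
          tensorPow (N + 1) (localGibbsProfile (fun _ => 1) (fun _ => (0 : V3)) (fun _ => θ₁)) z := by
      unfold tensorPow
      calc ∏ i, localGibbsProfile a₀ u₀ θ₀ (z i)
          ≤ ∏ i, (C * localGibbsProfile (fun _ => 1) (fun _ => (0 : V3)) (fun _ => θ₁) (z i)) :=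
            Finset.prod_le_prod (fun i _ => hfP0 (z i)) fun i _ => hC (z i)
        _ = C ^ (N + 1) *
              ∏ i, localGibbsProfile (fun _ => 1) (fun _ => (0 : V3)) (fun _ => θ₁) (z i) := by
            rw [Finset.prod_mul_distrib, Finset.prod_const, Finset.card_univ, Fintype.card_fin]
    have hinv : (posPartition a₀ (hsDiameter σ N) (N + 1))⁻¹ ≤
        (a ^ (N + 1) * posPartition (fun _ => (1 : ℝ)) (hsDiameter σ N) (N + 1))⁻¹ :=
      inv_anti₀ (by positivity) hZPge
    have htQ0 : 0 ≤
        tensorPow (N + 1) (localGibbsProfile (fun _ => 1) (fun _ => (0 : V3)) (fun _ => θ₁)) z :=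
      tensorPow_nonneg hfQ0 _ _
    calc (posPartition a₀ (hsDiameter σ N) (N + 1))⁻¹ *
          tensorPow (N + 1) (localGibbsProfile a₀ u₀ θ₀) z
        ≤ (a ^ (N + 1) * posPartition (fun _ => (1 : ℝ)) (hsDiameter σ N) (N + 1))⁻¹ *
            (C ^ (N + 1) * tensorPow (N + 1)
              (localGibbsProfile (fun _ => 1) (fun _ => (0 : V3)) (fun _ => θ₁)) z) :=
          mul_le_mul hinv htp (tensorPow_nonneg hfP0 _ _) (by positivity)
      _ = (C / a) ^ (N + 1) * ((posPartition (fun _ => (1 : ℝ)) (hsDiameter σ N) (N + 1))⁻¹ *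
            tensorPow (N + 1)
              (localGibbsProfile (fun _ => 1) (fun _ => (0 : V3)) (fun _ => θ₁)) z) := by
          rw [div_pow]
          field_simp
  · rw [indicator_of_notMem hz, indicator_of_notMem hz, mul_zero, mul_zero, mul_zero]

/-- **Domination of the local Gibbs laws by a homogeneous Gibbs law.** For continuous profiles
`a₀, θ₀ > 0`, `u₀` there are a temperature `θ₁ > 0` and a constant `Λ ≥ 1` such that for every
reduced diameter `σ ≤ 1/2` and every particle number,
`localGibbsMeasure σ a₀ u₀ θ₀ N ≤ Λ^{N+1} • localGibbsMeasure σ 1 0 θ₁ N`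
— the local Gibbs law is absolutely continuous with respect to the (flow-invariant) homogeneous Gibbs
law with density at most exponential in `N`. This is the measure-theoretic form of the order-`N`
relative entropy bound `H(local Gibbs | Gibbs) = O(N)`. [folklore] -/
theorem exists_localGibbsMeasure_le_smul_const (ha : Continuous a₀) (hθ : Continuous θ₀)
    (hu : Continuous u₀) (ha0 : ∀ x, 0 < a₀ x) (hθ0 : ∀ x, 0 < θ₀ x) :
    ∃ θ₁ : ℝ, 0 < θ₁ ∧ ∃ Λ : ℝ, 1 ≤ Λ ∧ ∀ σ : ℝ, σ ≤ 1 / 2 → ∀ N : ℕ,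
      localGibbsMeasure σ a₀ u₀ θ₀ N ≤
        ENNReal.ofReal (Λ ^ (N + 1)) •
          localGibbsMeasure σ (fun _ => 1) (fun _ => (0 : V3)) (fun _ => θ₁) N := by
  obtain ⟨A, a, Θ, ϑ, U, ha_pos, hϑ0, -, hA, haa, hΘ, hϑ, hU⟩ :=
    exists_profile_bounds ha hθ hu ha0 hθ0
  have hΘ0 : 0 < Θ := hϑ0.trans_le ((hϑ 0).trans (hΘ 0))
  obtain ⟨C, hC0, hC⟩ :=
    exists_localGibbsProfile_le_const (fun x => (ha0 x).le) hA hϑ0 hϑ hΘ hU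
  refine ⟨2 * Θ, by positivity, max (C / a) 1, le_max_right _ _, fun σ hσ N => ?_⟩
  have hfQ0 : 0 ≤ localGibbsProfile (fun _ => 1) (fun _ => (0 : V3)) (fun _ => 2 * Θ) :=
    fun y => localGibbsProfile_nonneg (fun _ => zero_le_one) (fun _ => by positivity) y
  have hpt : ∀ z : Config (N + 1) (Fin 3) T3,
      canonicalDensity (Torus.geometry (Fin 3)) (hsDiameter σ N) (N + 1)
          (localGibbsProfile a₀ u₀ θ₀) z ≤
        (max (C / a) 1) ^ (N + 1) *
          canonicalDensity (Torus.geometry (Fin 3)) (hsDiameter σ N) (N + 1)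
            (localGibbsProfile (fun _ => 1) (fun _ => (0 : V3)) (fun _ => 2 * Θ)) z := fun z =>
    (canonicalDensity_le_const_mul ha hθ hu ha0 hθ0 ha_pos haa (by positivity) hC hσ N
      z).trans (mul_le_mul_of_nonneg_right
        (pow_le_pow_left₀ (by positivity) (le_max_left _ _) _)
        (canonicalDensity_nonneg' hfQ0 _ _ z))
  unfold localGibbsMeasure
  rw [← withDensity_smul' _ _ ENNReal.ofReal_ne_top]
  refine withDensity_mono (Eventually.of_forall fun z => ?_)
  simp only [Pi.smul_apply, smul_eq_mul]
  rw [← ENNReal.ofReal_mul (by positivity)]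
  exact ENNReal.ofReal_le_ofReal (hpt z)

/-! ### The reduction to equilibrium exponential tails -/

/-- `exp (−(N+1)) ≤ δ` eventually. [folklore] -/
theorem exists_exp_neg_succ_le {δ : ℝ} (hδ : 0 < δ) :
    ∃ N₁ : ℕ, ∀ N : ℕ, N₁ ≤ N → Real.exp (-((N : ℝ) + 1)) ≤ δ := by
  obtain ⟨N₁, hN₁⟩ := exists_nat_gt (1 / δ)
  refine ⟨N₁, fun N hN => ?_⟩
  have h1 : (1 : ℝ) / δ ≤ (N : ℝ) + 1 := by
    have : (N₁ : ℝ) ≤ N := by exact_mod_cast hN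
    linarith
  have h2 : (N : ℝ) + 1 ≤ Real.exp ((N : ℝ) + 1) := by
    linarith [Real.add_one_le_exp ((N : ℝ) + 1)]
  rw [Real.exp_neg]
  calc (Real.exp ((N : ℝ) + 1))⁻¹ ≤ ((N : ℝ) + 1)⁻¹ := inv_anti₀ (by positivity) h2
    _ ≤ δ := by
        rw [inv_le_comm₀ (by positivity) hδ, ← one_div]
        exact h1

/-- **Collision tightness follows from exponential upper tails at equilibrium.** IF, for every
temperature `θ₁ > 0`, all small `σ`, every family of hard-sphere flows, every horizon `τ > 0` and
EVERY rate `c`, the normalised collision count `X_N = ε_N (N+1)⁻¹ #{collisions in [0, τ]}` has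
upper tails `G_N{K < X_N} ≤ exp(−c (N+1))` for `N ≥ N₀(c)` under the homogeneous (flow-invariant)
Gibbs laws `G_N = localGibbsLaw σ 1 0 θ₁ N Φ_N`, THEN `CollisionTightness` (the same tightness under
every continuous local Gibbs law) holds: by `exists_localGibbsMeasure_le_smul_const` the local Gibbs
probability of the tail event is at most `Λ^{N+1} exp(−c(N+1)) = exp(−(N+1))` for
`c = log Λ + 1`. The hypothesis is a speed-`N` large-deviation upper bound for the collision count of
the deterministic hard-sphere gas in equilibrium; it is OPEN (and the exponential loss `Λ^{N+1}` of any
global comparison cannot be avoided: the relative entropy of a local Gibbs law with non-constant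
profiles with respect to every invariant Gibbs law is of order `N`). [folklore] -/
theorem collisionTightness_of_equilibrium_exp_tails
    (hEq : ∀ θ₁ : ℝ, 0 < θ₁ → ∃ σ₀ : ℝ, 0 < σ₀ ∧ ∀ σ : ℝ, 0 < σ → σ < σ₀ →
      ∀ Φ : (N : ℕ) → HardSphereFlow (Torus.geometry (Fin 3)) (hsDiameter σ N) (N + 1),
      ∀ τ : ℝ, 0 < τ → ∀ c : ℝ, ∃ K : ℝ, ∃ N₀ : ℕ, ∀ N : ℕ, N₀ ≤ N →
        localGibbsLaw σ (fun _ => 1) (fun _ => (0 : V3)) (fun _ => θ₁) N (Φ N)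
          {z | K < hsDiameter σ N / (N + 1 : ℝ) *
            (numCollisions (Torus.geometry (Fin 3)) (hsDiameter σ N)
              (fun s => (Φ N).flow s z) 0 τ : ℝ)}
          ≤ ENNReal.ofReal (Real.exp (-c * (N + 1)))) :
    _root_.Summit.AtomisticToContinuum.HydrodynamicLimit.Theses.JParityClosure.CollisionTightness := by
  unfold Summit.AtomisticToContinuum.HydrodynamicLimit.Theses.JParityClosure.CollisionTightness
  intro a₀ θ₀ u₀ ha hθ hu ha0 hθ0
  obtain ⟨θ₁, hθ₁, Λ, hΛ, hdom⟩ := exists_localGibbsMeasure_le_smul_const ha hθ hu ha0 hθ0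
  obtain ⟨σ₀, hσ₀, H⟩ := hEq θ₁ hθ₁
  refine ⟨min σ₀ (1 / 2), lt_min hσ₀ (by norm_num), fun σ hσ hσlt Φ τ hτ δ hδ => ?_⟩
  have hσ₀' : σ < σ₀ := hσlt.trans_le (min_le_left _ _)
  have hσ2 : σ ≤ 1 / 2 := (hσlt.trans_le (min_le_right _ _)).le
  have hΛ0 : 0 < Λ := one_pos.trans_le hΛ
  set c : ℝ := Real.log Λ + 1 with hc
  obtain ⟨K, N₀, hK⟩ := H σ hσ hσ₀' Φ τ hτ c
  obtain ⟨N₁, hN₁⟩ := exists_exp_neg_succ_le hδ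
  refine ⟨K, max N₀ N₁, fun N hN => ?_⟩
  have hN0 : N₀ ≤ N := (le_max_left _ _).trans hN
  have hN1 : N₁ ≤ N := (le_max_right _ _).trans hN
  have hΛc : Λ * Real.exp (-c) = Real.exp (-1) := by
    rw [hc, neg_add, Real.exp_add, Real.exp_neg (Real.log Λ), Real.exp_log hΛ0]
    field_simp
  have hprod : Λ ^ (N + 1) * Real.exp (-c * ((N : ℝ) + 1)) = Real.exp (-((N : ℝ) + 1)) := by
    rw [show -c * ((N : ℝ) + 1) = ((N + 1 : ℕ) : ℝ) * (-c) by push_cast; ring,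
      Real.exp_nat_mul, ← mul_pow, hΛc, ← Real.exp_nat_mul]
    congr 1
    push_cast
    ring
  calc localGibbsLaw σ a₀ u₀ θ₀ N (Φ N)
        {z | K < hsDiameter σ N / (N + 1 : ℝ) *
          (numCollisions (Torus.geometry (Fin 3)) (hsDiameter σ N)
            (fun s => (Φ N).flow s z) 0 τ : ℝ)}
      = localGibbsMeasure σ a₀ u₀ θ₀ N
          {z | K < hsDiameter σ N / (N + 1 : ℝ) *
            (numCollisions (Torus.geometry (Fin 3)) (hsDiameter σ N)
              (fun s => (Φ N).flow s z) 0 τ : ℝ)} := by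
        rw [localGibbsLaw_eq]
    _ ≤ (ENNReal.ofReal (Λ ^ (N + 1)) •
          localGibbsMeasure σ (fun _ => 1) (fun _ => (0 : V3)) (fun _ => θ₁) N)
          {z | K < hsDiameter σ N / (N + 1 : ℝ) *
            (numCollisions (Torus.geometry (Fin 3)) (hsDiameter σ N)
              (fun s => (Φ N).flow s z) 0 τ : ℝ)} :=
        Measure.le_iff'.1 (hdom σ hσ2 N) _
    _ = ENNReal.ofReal (Λ ^ (N + 1)) *
          localGibbsLaw σ (fun _ => 1) (fun _ => (0 : V3)) (fun _ => θ₁) N (Φ N)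
          {z | K < hsDiameter σ N / (N + 1 : ℝ) *
            (numCollisions (Torus.geometry (Fin 3)) (hsDiameter σ N)
              (fun s => (Φ N).flow s z) 0 τ : ℝ)} := by
        rw [Measure.smul_apply, smul_eq_mul, localGibbsLaw_eq]
    _ ≤ ENNReal.ofReal (Λ ^ (N + 1)) * ENNReal.ofReal (Real.exp (-c * (N + 1))) :=
        by gcongr; exact hK N hN0
    _ = ENNReal.ofReal (Λ ^ (N + 1) * Real.exp (-c * ((N : ℝ) + 1))) :=
        (ENNReal.ofReal_mul (by positivity)).symm
    _ ≤ ENNReal.ofReal δ := ENNReal.ofReal_le_ofReal (hprod ▸ hN₁ N hN1)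

end Summit.AtomisticToContinuum.HydrodynamicLimit.Theorems

end
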